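import Summits.QuantumFields.YangMills.Theorems.SwapVirialDeficitZeroModeThreeBound
import Summits.QuantumFields.YangMills.Theorems.ToronValleyVolumeZeroModeVirial
import HarnessLib

/-!
# The `k = 3` zero-mode block is REGULAR, III: ★★★ NO LOG — `β²·Z₃(β) → A₃ ∈ (0,∞)`, `A₃ = ∫∫h_∞`
# (free-hands support of crux ⟨stmt-QuantumFields-24197⟩ `SwapVirialDeficit.SwapGluedStiffness`, LINE «sharp-sigma» of planner seat ym-idea-4; the σ
# twin of the periodic ONE-LOG rung ✓`ToronValleyVolumeZeroModeLog4Rung.stub_rung_zeroModeLog4` `β³Z₄(β)/log β → A`)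

From file I (✓`zeroModeZ_three_sq_mul_monotoneOn`: `β ↦ β²Z₃(β)` increasing, by the monotone blow-up `h_β ↑ h_∞` of the 4 normal directions of the
commuting-triple cone) and file II (✓`zeroModeZ_three_sq_mul_le`: `β²Z₃(β) ≤ B₃ < ∞`, by symmetrisation over the largest column and the `β`-,`r`-free kernel
`κ₂`): a monotone bounded function converges —

★★★ `tendsto_zeroModeZ_three : Tendsto (fun β => β ^ 2 * zeroModeZ 3 β) atTop (𝓝 A3)`, `A3_pos : 0 < A3`,
★★★ `zeroModeZ_three_noLog : ∃ A : ℝ, 0 < A ∧ Tendsto (fun β : ℝ => β ^ 2 * zeroModeZ 3 β) atTop (𝓝 A)` —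

the Gaussian-regularised commuting-TRIPLE block `Z₃(β) = ∫_{(ℝ³)³} exp(−β Σ_{μ<ν}‖c_μ×c_ν‖² − |c|²/2) dc` has the PURE POWER LAW `A₃ β⁻²`: real
log-canonical threshold `2` with MULTIPLICITY ONE (no logarithm), as the LINE card «sharp-sigma» (bc/g14-B/sigma) predicts for the zero-mode block of the
σ-glued ring (there in `t`-units: `m₃(t) = v t²(1+o(1))`), in contrast with the periodic `k = 4` block (threshold `3`, multiplicity two, one log).
§10 identifies the limit by monotone convergence: ★ `ofReal_A3_eq`: `A₃ = ∫_{ℝ³} da ∫_{(ℝ³)²} dy h_∞(‖a‖,y)`, the `β = ∞` Gaussian integral over the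
normal bundle of the cone — in closed form `4π⁴√(2π)` (not proved here).

HONEST LABEL: a finite-dimensional Laplace asymptotic (plan-level zero-mode rung); it is NOT the fixed-`L` sharp small-ball law of the σ-glued ring,
NOT `SharpSwapVolumeLaw` / `SharpSwapLaplace`, and closes no item: ⟨24197⟩, ⟨24194⟩ and every rung / summit statement stay OPEN; the Yang–Mills mass
gap is NOT proved; no summit is proved by a line.  Width seat ym-line-sfw-p2-w3 g62 (cell ym-idea-1, free hands; own crux ⟨22884⟩ blocked-on ⟨19935⟩),
`--supports stmt-QuantumFields-24197`.  Standard axioms, 0 `sorry`.  References: [cite: tHooft1979]; [cite: Vanbaal2001]; [folklore] (monotone convergence).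
-/

set_option autoImplicit false

noncomputable section

namespace Summit.QuantumFields.YangMills.Theorems.ToronValleyVolume.ZeroMode

open MeasureTheory Real Finset Set Filter
open scoped ENNReal Topology
open Summit.QuantumFields.YangMills.Cruxes.ToronTubeVolumeLaw.Birth

/-! ## §9 The limit: a monotone bounded function converges -/

/-- The regularised profile `g(β) = (max β 1)²·Z₃(max β 1)` — monotone on all of `ℝ`, equal to `β²Z₃(β)` for `β ≥ 1`. -/
def gmax3 (β : ℝ) : ℝ := (max β 1) ^ 2 * zeroModeZ 3 (max β 1)

/-- `g` is monotone. [folklore] -/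
theorem gmax3_monotone : Monotone gmax3 := by
  intro β β' h
  unfold gmax3
  exact zeroModeZ_three_sq_mul_monotoneOn (show (0 : ℝ) < max β 1 from lt_max_of_lt_right one_pos)
    (show (0 : ℝ) < max β' 1 from lt_max_of_lt_right one_pos) (max_le_max h le_rfl)

/-- `g ≤ B₃`. [folklore] -/
theorem gmax3_le_B3 (β : ℝ) : gmax3 β ≤ B3.toReal := zeroModeZ_three_sq_mul_le (lt_max_of_lt_right one_pos)

/-- `g` is bounded above. [folklore] -/
theorem bddAbove_range_gmax3 : BddAbove (Set.range gmax3) :=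
  ⟨B3.toReal, by rintro _ ⟨β, rfl⟩; exact gmax3_le_B3 β⟩

/-- THE LIMIT CONSTANT `A₃ = sup_β β²·Z₃(β)` (`= lim`, `= ∫∫h_∞` by `ofReal_A3_eq`; closed form `4π⁴√(2π)`, not proved here). -/
def A3 : ℝ := ⨆ β : ℝ, gmax3 β

/-- `g(β) → A₃`. [folklore] -/
theorem tendsto_gmax3 : Tendsto gmax3 atTop (𝓝 A3) := tendsto_atTop_ciSup gmax3_monotone bddAbove_range_gmax3

/-- ★★★ **NO LOG FOR THE COMMUTING-TRIPLE BLOCK**: `β²·Z₃(β) → A₃` as `β → ∞`. [folklore] -/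
theorem tendsto_zeroModeZ_three : Tendsto (fun β : ℝ => β ^ 2 * zeroModeZ 3 β) atTop (𝓝 A3) := by
  refine tendsto_gmax3.congr' ?_
  filter_upwards [eventually_ge_atTop (1 : ℝ)] with β hβ
  unfold gmax3; rw [max_eq_left hβ]

/-- `A₃ > 0`. [folklore] -/
theorem A3_pos : 0 < A3 := by
  have h1 : gmax3 1 ≤ A3 := le_ciSup bddAbove_range_gmax3 1
  have h2 : 0 < gmax3 1 := by
    unfold gmax3; rw [max_self, one_pow, one_mul]; exact zeroModeZ_pos 3 zero_le_one
  linarith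

/-- `A₃ ≤ B₃`. [folklore] -/
theorem A3_le_B3 : A3 ≤ B3.toReal := ciSup_le gmax3_le_B3

/-- Monotone limit from below: `β²·Z₃(β) ≤ A₃` for every `β > 0`. [folklore] -/
theorem sq_mul_zeroModeZ_three_le_A3 {β : ℝ} (hβ : 0 < β) : β ^ 2 * zeroModeZ 3 β ≤ A3 := by
  have h1 : β ^ 2 * zeroModeZ 3 β ≤ gmax3 β := by
    unfold gmax3
    exact zeroModeZ_three_sq_mul_monotoneOn hβ (show (0 : ℝ) < max β 1 from lt_max_of_lt_right one_pos)
      (le_max_left β 1)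
  exact h1.trans (le_ciSup bddAbove_range_gmax3 β)

/-- ★★★ **THE `k = 3` ZERO-MODE RUNG (σ-sector, LINE «sharp-sigma»), packaged**: `∃ A > 0, β²·Z₃(β) → A` — exponent `2`, multiplicity `1`,
NO logarithm (compare ✓`stub_rung_zeroModeLog4`: `β³Z₄(β)/log β → A`). [folklore] -/
theorem zeroModeZ_three_noLog : ∃ A : ℝ, 0 < A ∧ Tendsto (fun β : ℝ => β ^ 2 * zeroModeZ 3 β) atTop (𝓝 A) :=
  ⟨A3, A3_pos, tendsto_zeroModeZ_three⟩

/-! ## §10 Identification of the limit by monotone convergence: `A₃ = ∫ da ∫ dy h_∞(‖a‖, y)` -/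

/-- Joint measurability of `(a,y) ↦ h_β(‖a‖,y)`. [folklore] -/
theorem measurable_hsc_norm (β : ℝ) :
    Measurable (fun p : EuclideanSpace ℝ (Fin 3) × (Fin 2 → EuclideanSpace ℝ (Fin 3)) => ENNReal.ofReal (hsc β ‖p.1‖ p.2)) := by
  refine ENNReal.measurable_ofReal.comp (Continuous.measurable ?_)
  unfold hsc cr plSq
  fun_prop

/-- Measurability of `a ↦ ∫ h_β(‖a‖,y) dy`. [folklore] -/
theorem measurable_lintegral_hsc (β : ℝ) :
    Measurable (fun a : EuclideanSpace ℝ (Fin 3) => ∫⁻ y, ENNReal.ofReal (hsc β ‖a‖ y)) :=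
  (measurable_hsc_norm β).lintegral_prod_right'

/-- Pointwise monotone convergence along `β = n + 1`: `⨆_n h_{n+1}(r,y) = h_∞(r,y)`. [folklore] -/
theorem iSup_ofReal_hsc_nat (r : ℝ) (y : Fin 2 → EuclideanSpace ℝ (Fin 3)) :
    ⨆ n : ℕ, ENNReal.ofReal (hsc ((n : ℝ) + 1) r y) = ENNReal.ofReal (hlim r y) := by
  have hmono : Monotone (fun n : ℕ => ENNReal.ofReal (hsc ((n : ℝ) + 1) r y)) := fun m n h =>
    ENNReal.ofReal_le_ofReal (hsc_mono (by positivity) (by exact_mod_cast Nat.succ_le_succ h) r y)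
  have ht : Tendsto (fun n : ℕ => ENNReal.ofReal (hsc ((n : ℝ) + 1) r y)) atTop (𝓝 (ENNReal.ofReal (hlim r y))) :=
    (ENNReal.continuous_ofReal.tendsto _).comp
      ((tendsto_hsc r y).comp (tendsto_atTop_add_const_right _ 1 tendsto_natCast_atTop_atTop))
  exact tendsto_nhds_unique (tendsto_atTop_iSup hmono) ht

/-- MONOTONE CONVERGENCE: `∫∫ h_∞ = ⨆_n ∫∫ h_{n+1}`. [folklore] -/
theorem lintegral_hlim_eq_iSup :
    ∫⁻ a : EuclideanSpace ℝ (Fin 3), ∫⁻ y, ENNReal.ofReal (hlim ‖a‖ y) =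
      ⨆ n : ℕ, ∫⁻ a : EuclideanSpace ℝ (Fin 3), ∫⁻ y, ENNReal.ofReal (hsc ((n : ℝ) + 1) ‖a‖ y) := by
  have hmono_in : ∀ r : ℝ, Monotone (fun (n : ℕ) (y : Fin 2 → EuclideanSpace ℝ (Fin 3)) =>
      ENNReal.ofReal (hsc ((n : ℝ) + 1) r y)) := fun r m n h y =>
    ENNReal.ofReal_le_ofReal (hsc_mono (by positivity) (by exact_mod_cast Nat.succ_le_succ h) r y)
  have hmono_out : Monotone (fun (n : ℕ) (a : EuclideanSpace ℝ (Fin 3)) => ∫⁻ y, ENNReal.ofReal (hsc ((n : ℝ) + 1) ‖a‖ y)) :=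
    fun m n h a => lintegral_mono fun y => hmono_in ‖a‖ h y
  rw [← lintegral_iSup (fun n => measurable_lintegral_hsc _) hmono_out]
  refine lintegral_congr fun a => ?_
  rw [← lintegral_iSup (fun n => (measurable_hsc ((n : ℝ) + 1) ‖a‖).ennreal_ofReal) (hmono_in ‖a‖)]
  exact lintegral_congr fun y => (iSup_ofReal_hsc_nat ‖a‖ y).symm

/-- ★ **IDENTIFICATION OF THE LIMIT**: `A₃ = ∫_{ℝ³} da ∫_{(ℝ³)²} dy h_∞(‖a‖,y)` — the `β = ∞` Gaussian integral over the normal bundle of the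
commuting-triple cone (as an extended real). [folklore] -/
theorem ofReal_A3_eq : ENNReal.ofReal A3 = ∫⁻ a : EuclideanSpace ℝ (Fin 3), ∫⁻ y, ENNReal.ofReal (hlim ‖a‖ y) := by
  rw [lintegral_hlim_eq_iSup]
  have hseq : ∀ n : ℕ, (∫⁻ a : EuclideanSpace ℝ (Fin 3), ∫⁻ y, ENNReal.ofReal (hsc ((n : ℝ) + 1) ‖a‖ y)) =
      ENNReal.ofReal ((((n : ℝ) + 1)) ^ 2 * zeroModeZ 3 ((n : ℝ) + 1)) := fun n =>
    (ofReal_sq_mul_zeroModeZ_three (by positivity)).symm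
  simp_rw [hseq]
  have hmono : Monotone (fun n : ℕ => ENNReal.ofReal ((((n : ℝ) + 1)) ^ 2 * zeroModeZ 3 ((n : ℝ) + 1))) := fun m n h =>
    ENNReal.ofReal_le_ofReal (zeroModeZ_three_sq_mul_monotoneOn (show (0 : ℝ) < (m : ℝ) + 1 by positivity)
      (show (0 : ℝ) < (n : ℝ) + 1 by positivity) (by exact_mod_cast Nat.succ_le_succ h))
  have ht : Tendsto (fun n : ℕ => ENNReal.ofReal ((((n : ℝ) + 1)) ^ 2 * zeroModeZ 3 ((n : ℝ) + 1))) atTop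
      (𝓝 (ENNReal.ofReal A3)) :=
    (ENNReal.continuous_ofReal.tendsto _).comp
      (tendsto_zeroModeZ_three.comp (tendsto_atTop_add_const_right _ 1 tendsto_natCast_atTop_atTop))
  exact (tendsto_nhds_unique (tendsto_atTop_iSup hmono) ht).symm

/-- Corollary: the `β = ∞` Gaussian integral over the normal bundle of the commuting-triple cone is FINITE. [folklore] -/
theorem lintegral_hlim_lt_top : ∫⁻ a : EuclideanSpace ℝ (Fin 3), ∫⁻ y, ENNReal.ofReal (hlim ‖a‖ y) < ⊤ := by
  rw [← ofReal_A3_eq]; exact ENNReal.ofReal_lt_top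

/-- `A₃` as the real part of the limit integral. [folklore] -/
theorem A3_eq_toReal : A3 = (∫⁻ a : EuclideanSpace ℝ (Fin 3), ∫⁻ y, ENNReal.ofReal (hlim ‖a‖ y)).toReal := by
  rw [← ofReal_A3_eq, ENNReal.toReal_ofReal A3_pos.le]

end Summit.QuantumFields.YangMills.Theorems.ToronValleyVolume.ZeroMode

end
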